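import Summits.BirchSwinnertonDyer.BirchSwinnertonDyer.Theorems.SignedLowerHalvesSmallImageLowerHalfBothSignsRttCharRoadE1LocalSquare
import Literature.NumberTheory.GaloisRepresentations.ArtinFormalismInductionProofs
import Mathlib.FieldTheory.Galois.Infinite
import HarnessLib

/-!
# Route `SignedLowerHalves`, crux L `SmallImageLowerHalfBothSigns` (stmt-BirchSwinnertonDyer-23599), line `rtt_w3` v11 — brick D3-W, CONCRETE HALF,
# part 5 (memo `Lines/rtt_w3-MEMO-D3c-w3g17.md` §6 (W5)): THE REMAINING DATA of the local base-change square at an inert prime —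
# the index `[Γ_k : galRange K] = 2`, a Frobenius-type element `c ∈ Gal(K̄_E/k_n·E)` restricting OUTSIDE `galRange K`, and its source:
# an element of `Γ_E` moving `K` exists as soon as `K ⊄ E` inside `E'` (no `k`-embedding `K → E`, i.e. the prime does not split).

Width seat `bsd-line-slh-p3-w3` g17 under LEAD `cruxlead-stmt-BirchSwinnertonDyer-23599` (cell `bsd-ssimc`; `--supports stmt-BirchSwinnertonDyer-23599 --as helper`).
THEOREMS ONLY (no definition, no named fact, no instance, no `sorry`). The square itself — `ι₂ : Ē ≃ Ē'`, `ι' ∘ ι_K = ι₂ ∘ ι`, `ι₂|_E = f`, the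
fixing hypothesis for `galRange K` — is PRODUCED at the completions by cell bsd-potss's `EtaLayer.exists_package_adicCompletion[_of_embedding]`
(`Theorems/QuadraticBranchSignedControlEtaLayerPackages`); this file supplies what parts 1–4 (p765739, p765761, p765933, p766226) and the final
local form (`…RttCharRoadE1LocalAtP`) consume on top of a package. BSD / crux L / INJ are NOT proved here.

* `index_galRange_eq_two` — `(galRange K).index = 2` for `[K : k] = 2` (the tree's `index_range_absGaloisRestrict_eq_finrank`).
* `pow_prime_pow_mem_localSubgroupOfEmb_layerSubgroup` — `τ^{pⁿ} ∈ Λ_n = localSubgroupOfEmb (κ.layerSubgroup n) ι` for every `τ ∈ Γ_E`.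
* `pow_not_mem_of_index_two` — an odd power of `g ∉ U` is `∉ U` (`U` of index `2`).
* ★ `exists_mem_localSubgroupOfEmb_layerSubgroup_not_mem` — `p` odd: from ONE `τ ∈ Γ_E` with `res_ι τ ∉ U` get, at every layer `n`,
  `c = τ^{pⁿ} ∈ Λ_n` with `res_ι c ∉ U` (the `c` of parts 1–4).
* ★ `exists_resGalOfEmb_not_mem_galRange` — given the square `(ι, ι₂, ι', hcompat)`, `f : E → E'` with `ι₂|_E = f`, and `θ₀ ∈ K` whose image in
  `E'` is not in `f(E)`: some `τ ∈ Γ_E` has `res_ι τ ∉ galRange K` (else `ι(θ₀)` is `Γ_E`-fixed, hence in `E` by infinite Galois theory, and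
  `θ₀ ∈ f(E)`).
* `exists_algebraMap_not_mem_range` — such a `θ₀` exists when `E' = f(E)·K` (`Subring.closure`, the package's generation) and `f` is not onto
  (local degree `> 1`, the inert case).

References: [SerreGaloisCohomology1997] II §1.1; [NeukirchANT1999] II §8–§9 (decomposition groups; `L ⊗_K K_v = ∏ L_w`); [Washington1997] §13.1.
-/

set_option autoImplicit false
set_option linter.dupNamespace false -- D-0017: single-problem summit, the namespace repeats the problem name by design
noncomputable section

open scoped Classical

universe u

namespace Summit.BirchSwinnertonDyer.BirchSwinnertonDyer.Theorems.SmallImageCharSignedSelmer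

open Literature.NumberTheory.EllipticCurves Literature.NumberTheory.GaloisRepresentations Field

/-! ## §1 The index of `galRange K` -/

section Index

variable {k : Type u} [Field k] [NumberField k] (K : Type u) [Field K] [NumberField K] [Algebra k K]

/-- `[Γ_k : galRange K] = [K : k]`, so `= 2` for a quadratic extension. [cite: NeukirchANT1999, IV §1] -/
theorem index_galRange_eq_two (hK2 : Module.finrank k K = 2) : (galRange (K := k) K).index = 2 := by
  rw [← hK2]
  exact index_range_absGaloisRestrict_eq_finrank k K

end Index

/-! ## §2 A Frobenius-type element in every layer -/

section Frobenius

variable {k : Type u} [Field k] {p : ℕ} [hp : Fact p.Prime] (κ : ZpExtension k p) {U : Subgroup (absoluteGaloisGroup k)}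
  {E : Type u} [Field E] [Algebra k E] (ι : AlgebraicClosure k →ₐ[k] AlgebraicClosure E)

/-- `τ^{pⁿ} ∈ Λ_n = localSubgroupOfEmb (κ.layerSubgroup n) ι` for every `τ ∈ Γ_E` (`κ(g^{pⁿ}) = pⁿκ(g)`). [cite: Washington1997, §13.1] -/
theorem pow_prime_pow_mem_localSubgroupOfEmb_layerSubgroup (τ : absoluteGaloisGroup E) (n : ℕ) :
    τ ^ p ^ n ∈ localSubgroupOfEmb (κ.layerSubgroup n) ι := by
  rw [mem_localSubgroupOfEmb_iff, map_pow, ZpExtension.mem_layerSubgroup, map_pow, toAdd_pow, nsmul_eq_mul, Nat.cast_pow]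
  exact Dvd.intro _ rfl

omit hp in
/-- An odd power of an element outside an index-`2` subgroup is outside it. [cite: SerreGaloisCohomology1997, I §2.6 (b)] -/
theorem pow_not_mem_of_index_two (hU : U.index = 2) {g : absoluteGaloisGroup k} (hg : g ∉ U) {m : ℕ} (hm : Odd m) : g ^ m ∉ U := by
  obtain ⟨j, rfl⟩ := hm
  rw [pow_succ, pow_mul]
  intro h
  have h2 : (g ^ 2) ^ j ∈ U := U.pow_mem (by rw [pow_two]; exact Subgroup.mul_self_mem_of_index_two hU g) j
  exact hg ((U.mul_mem_cancel_left h2).1 h)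

/-- ★ **A Frobenius-type element in every layer.** For `p` odd, `U ≤ Γ_k` of index `2` and ONE `τ ∈ Γ_E` with `res_ι τ ∉ U`, every layer group
`Λ_n = localSubgroupOfEmb (κ.layerSubgroup n) ι` contains `c = τ^{pⁿ}` with `res_ι c ∉ U` (`pⁿ` is odd). In D3-W: `U = galRange K`, `τ` any element of
the decomposition group at the inert prime acting non-trivially on `K`. [cite: NeukirchANT1999, II §9] [cite: Washington1997, §13.1] -/
theorem exists_mem_localSubgroupOfEmb_layerSubgroup_not_mem (hp2 : p ≠ 2) (hU : U.index = 2) {τ : absoluteGaloisGroup E}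
    (hτ : resGalOfEmb ι τ ∉ U) (n : ℕ) : ∃ c ∈ localSubgroupOfEmb (κ.layerSubgroup n) ι, resGalOfEmb ι c ∉ U :=
  ⟨τ ^ p ^ n, pow_prime_pow_mem_localSubgroupOfEmb_layerSubgroup κ ι τ n, by
    rw [map_pow]; exact pow_not_mem_of_index_two hU hτ (hp.out.odd_of_ne_two hp2).pow⟩

end Frobenius

/-! ## §3 An element of `Γ_E` moving `K` -/

section NotSplit

variable {k : Type u} [Field k] (K : Type u) [Field K] [Algebra k K] [Algebra.IsAlgebraic k K]
  {E : Type u} [Field E] [Algebra k E] [CharZero E] {E' : Type u} [Field E'] [Algebra K E']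
  (ι : AlgebraicClosure k →ₐ[k] AlgebraicClosure E) (ι₂ : AlgebraicClosure E ≃+* AlgebraicClosure E')
  (ι' : AlgebraicClosure K →ₐ[K] AlgebraicClosure E')
  (hcompat : ∀ z : AlgebraicClosure k, ι' (closureEmb (K := k) K z) = ι₂ (ι z))
  (f : E →+* E') (hf : ∀ a : E, ι₂ (algebraMap E (AlgebraicClosure E) a) = algebraMap E' (AlgebraicClosure E') (f a))

include hcompat hf in
/-- ★ **Some `τ ∈ Γ_E` restricts outside `galRange K`** when `K ⊄ f(E)` inside `E'`: given the square `(ι, ι₂, ι', hcompat)`, `ι₂|_E = f`, and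
`θ₀ ∈ K` with `θ₀ ∉ f(E)` in `E'`. Otherwise every `τ` restricts into `galRange K`, so `τ` fixes `ι(z₀)` for the preimage `z₀ ∈ k̄` of `θ₀`
(`smul_eq_of_mem_galRange`, `ι ∘ res_ι τ = τ ∘ ι`); by infinite Galois theory (`Ē/E` Galois, `E` of characteristic `0`) `ι(z₀) = a ∈ E`, and applying
`ι₂`: `f(a) = θ₀` in `E'` — a contradiction. In D3-W: `E = ℚ_p`, `E' = K_v`, `p` inert, `θ₀ = √d`. [cite: SerreGaloisCohomology1997, II §1.1]
[cite: NeukirchANT1999, II §9] -/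
theorem exists_resGalOfEmb_not_mem_galRange {θ₀ : K} (hθ₀ : algebraMap K E' θ₀ ∉ Set.range f) :
    ∃ τ : absoluteGaloisGroup E, resGalOfEmb ι τ ∉ galRange (K := k) K := by
  by_contra hall
  push Not at hall
  -- the preimage `z₀ ∈ k̄` of `θ₀`
  set e : AlgebraicClosure k ≃ₐ[k] AlgebraicClosure K := algEquivOfEmb K (closureEmb (K := k) K) with he
  set z₀ : AlgebraicClosure k := e.symm (algebraMap K (AlgebraicClosure K) θ₀) with hz₀
  have hz₀' : closureEmb (K := k) K z₀ = algebraMap K (AlgebraicClosure K) θ₀ := by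
    rw [hz₀, ← algEquivOfEmb_apply K (closureEmb (K := k) K), AlgEquiv.apply_symm_apply]
  clear_value z₀
  -- `ι z₀` is fixed by all of `Γ_E`
  have hfix : ∀ τ : absoluteGaloisGroup E, (show AlgebraicClosure E ≃ₐ[E] AlgebraicClosure E from τ) (ι z₀) = ι z₀ := fun τ ↦ by
    have h1 := apply_resGalAuxOfEmb_apply ι τ z₀
    have h2 : (show AlgebraicClosure k ≃ₐ[k] AlgebraicClosure k from resGalAuxOfEmb ι τ) z₀ = z₀ :=
      smul_eq_of_mem_galRange K (hall τ) z₀ θ₀ hz₀'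
    rw [h2] at h1
    exact h1.symm
  -- hence `ι z₀ ∈ E`
  haveI : IsGalois E (AlgebraicClosure E) := {}
  obtain ⟨a, ha⟩ := (InfiniteGalois.mem_range_algebraMap_iff_fixed (ι z₀)).2 fun g ↦ hfix g
  -- and `f a = θ₀` in `E'`
  refine hθ₀ ⟨a, (algebraMap E' (AlgebraicClosure E')).injective ?_⟩
  rw [← hf, ha, ← hcompat, hz₀', AlgHom.commutes, IsScalarTower.algebraMap_apply K E' (AlgebraicClosure E')]

omit [Algebra.IsAlgebraic k K] [Algebra k E] [CharZero E] in
/-- **`θ₀` exists when `E' = f(E)·K` and `f` is not onto** (local degree `> 1`): if every `θ₀ ∈ K` lay in `f(E)` then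
`E' = closure(f(E) ∪ K) ⊆ f(E)`. The generation is the package's (`closure_range_adicCompletionMap_union_eq_top`, `K_w = K_v·K`).
[cite: NeukirchANT1999, II §8] -/
theorem exists_algebraMap_not_mem_range (hgen : Subring.closure (Set.range f ∪ Set.range (algebraMap K E')) = ⊤)
    (hf2 : ¬ Function.Surjective f) : ∃ θ₀ : K, algebraMap K E' θ₀ ∉ Set.range f := by
  by_contra h
  push Not at h
  apply hf2
  have hle : Subring.closure (Set.range f ∪ Set.range (algebraMap K E')) ≤ f.range := by
    rw [Subring.closure_le]
    rintro y (⟨a, rfl⟩ | ⟨x, rfl⟩)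
    · exact ⟨a, rfl⟩
    · exact h x
  rw [hgen, top_le_iff] at hle
  intro y
  exact RingHom.mem_range.1 (hle ▸ Subring.mem_top y)

omit [Algebra.IsAlgebraic k K] [Algebra k E] [CharZero E] [Algebra K E'] in
/-- **`f` is not onto when the local degree is not `1`**: a surjective `f : E → E'` is an `E`-algebra isomorphism for `Algebra E E' := f`, so
`[E' : E] = 1`. [folklore] -/
theorem not_surjective_of_finrank_ne_one [Algebra E E'] (hfE : ∀ a : E, f a = algebraMap E E' a) (h1 : Module.finrank E E' ≠ 1) :
    ¬ Function.Surjective f := by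
  intro hsurj
  apply h1
  have hbij : Function.Bijective (Algebra.ofId E E') :=
    ⟨(algebraMap E E').injective, fun y ↦ by obtain ⟨a, rfl⟩ := hsurj y; exact ⟨a, (hfE a).symm⟩⟩
  rw [← (AlgEquiv.ofBijective (Algebra.ofId E E') hbij).toLinearEquiv.finrank_eq, Module.finrank_self]

end NotSplit

/-! ## §4 The same with `CharZero k` (no instance on `E` at the call site) -/

section NotSplitCharZero

variable {k : Type u} [Field k] [CharZero k] (K : Type u) [Field K] [Algebra k K] [Algebra.IsAlgebraic k K]
  {E : Type u} [Field E] [Algebra k E] {E' : Type u} [Field E'] [Algebra K E']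
  (ι : AlgebraicClosure k →ₐ[k] AlgebraicClosure E) (ι₂ : AlgebraicClosure E ≃+* AlgebraicClosure E')
  (ι' : AlgebraicClosure K →ₐ[K] AlgebraicClosure E')
  (hcompat : ∀ z : AlgebraicClosure k, ι' (closureEmb (K := k) K z) = ι₂ (ι z))
  (f : E →+* E') (hf : ∀ a : E, ι₂ (algebraMap E (AlgebraicClosure E) a) = algebraMap E' (AlgebraicClosure E') (f a))

include hcompat hf in
/-- `exists_resGalOfEmb_not_mem_galRange` with the characteristic-`0` hypothesis on `k` (so that no `CharZero E` instance — and with it no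
second `ℚ`-algebra structure on a completion `E` — is in scope at the call site). [cite: SerreGaloisCohomology1997, II §1.1] -/
theorem exists_resGalOfEmb_not_mem_galRange_of_charZero {θ₀ : K} (hθ₀ : algebraMap K E' θ₀ ∉ Set.range f) :
    ∃ τ : absoluteGaloisGroup E, resGalOfEmb ι τ ∉ galRange (K := k) K := by
  haveI : CharZero E := charZero_of_injective_algebraMap (algebraMap k E).injective
  exact exists_resGalOfEmb_not_mem_galRange K ι ι₂ ι' hcompat f hf hθ₀

end NotSplitCharZero

end Summit.BirchSwinnertonDyer.BirchSwinnertonDyer.Theorems.SmallImageCharSignedSelmer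

end
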